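import Literature.Analysis.FluidPDE.KatoLocalL3Exists
import HarnessLib

/-!
# Kato's local existence theorem in `L³(ℝ³)`: discharge of `kato_local`

Analysis/FluidPDE proof file. The named fact `Literature.Analysis.FluidPDE.kato_local`
(`MildSolutions.lean`; Kato, *Math. Z.* 187 (1984), Thm. 1, the case `m = 3`: for `ν > 0` and a
weakly divergence-free `u₀ ∈ L³(ℝ³)` there are `T > 0` and a mild solution `u ∈ C([0,T); L³)` of
the unforced Navier–Stokes equations with `u(0) = u₀`, measurable on `(0,T) × ℝ³`) is **proved**
here from two results already in the tree:

* `kato_local_L3_holds` (`KatoLocalL3Exists.lean`): Kato's theorem in its weighted form — a mild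
  solution in `C([0,T₀); L³)` with `‖u(t)‖_∞ ≤ C t^{-1/2}` exists on every window `(0, T₀)` on
  which the free evolution is small, `t^{1/4} ‖e^{νtΔ} u₀‖₆ ≤ δ₀ ν^{3/4}` (Kato 1984, Thm. 1;
  Lemarié-Rieusset 2016, Thm. 7.5, proof PDF pp. 155–158);
* `exists_uniform_small_free_evolution` (`MildL3Smooth.lean`): for a family continuous in `L³`
  on a set containing a compact `K`, such a window exists uniformly in `s ∈ K` — applied to the
  constant family `s ↦ u₀` on `K = {0}` this is the classical remark that
  `t^{1/4} ‖e^{νtΔ} u₀‖₆ → 0` as `t → 0⁺` for `u₀ ∈ L³` (density of `L³ ∩ L⁶` and the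
  `L³ → L⁶` smoothing estimate).

Dropping the weighted `L^∞` bound from the conclusion of `kato_local_L3` gives `kato_local`
verbatim. Nothing is restated; `kato_local` stays a `def` and its users are fed `kato_local_holds`.

## References

* T. Kato, *Strong `Lᵖ`-solutions of the Navier–Stokes equation in `ℝᵐ`, with applications to
  weak solutions*, Math. Z. 187 (1984), 471–480, Thm. 1. [Kato1984]
* P. G. Lemarié-Rieusset, *The Navier–Stokes Problem in the 21st Century*, CRC Press (2016),
  doi:10.1201/b19556, Thm. 7.5 and its proof (PDF pp. 155–158). [LemarieRieusset2016]
-/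

noncomputable section

open MeasureTheory Set Function Filter
open _root_.Topology
open scoped ENNReal NNReal

namespace Literature.Analysis.FluidPDE

/-- A family constant in time, `t ↦ u₀` with `u₀ ∈ Lᵖ`, is continuous in `Lᵖ` on every set of
times (all increments vanish identically). [folklore] -/
theorem continuousInLpOn_const_of_memLp {p : ℝ≥0∞} {u₀ : EuclideanSpace ℝ (Fin 3) → EuclideanSpace ℝ (Fin 3)} (hu₀ : MemLp u₀ p volume)
    (S : Set ℝ) : ContinuousInLpOn S p (fun _ : ℝ => u₀) := by
  refine ⟨fun _ _ => hu₀, fun t₀ _ => ?_⟩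
  simp only [sub_self, eLpNorm_zero]
  exact tendsto_const_nhds

/-- **Kato's local existence theorem in `L³(ℝ³)`, proved** (discharge of the named fact
`kato_local`; Kato 1984, Thm. 1, case `m = 3`): for `ν > 0` and a weakly divergence-free
`u₀ ∈ L³(ℝ³)`, the free evolution satisfies `t^{1/4} ‖e^{νtΔ} u₀‖₆ ≤ δ₀ ν^{3/4}` on some window
`(0, T₀)` (`exists_uniform_small_free_evolution` for the constant family `s ↦ u₀` on `K = {0}`),
on which Kato's weighted theorem `kato_local_L3_holds` produces the mild solution
`u ∈ C([0,T₀); L³)` with `u(0) = u₀`, measurable on `(0,T₀) × ℝ³`; the weighted `L^∞` bound is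
discarded. [cite: Kato1984, Thm. 1] -/
theorem kato_local_holds : kato_local := by
  intro ν hν u₀ hu₀ hdiv
  obtain ⟨δ₀, hδ₀, hK⟩ := kato_local_L3_holds
  have hη : 0 < δ₀ * ν ^ (3 / 4 : ℝ) := by positivity
  obtain ⟨T₀, hT₀, hsmall⟩ := exists_uniform_small_free_evolution hν
    (isCompact_singleton (x := (0 : ℝ))) (singleton_subset_iff.2 (mem_singleton (0 : ℝ)))
    (continuousInLpOn_const_of_memLp hu₀ {(0 : ℝ)}) hη
  obtain ⟨u, hu, huc, hu0, hum, -⟩ :=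
    hK hν hT₀ hu₀ hdiv fun t ht => hsmall 0 (mem_singleton (0 : ℝ)) t ht
  exact ⟨T₀, hT₀, u, hu, huc, hu0, hum⟩

end Literature.Analysis.FluidPDE

end
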